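import Literature.Computability.Cryptography.HallgrenClassGroupTorsionWitnessCount
import Literature.Computability.Cryptography.HallgrenClassGroupCrowdedNorms
import HarnessLib

/-!
# Hallgren 2005 / class groups — the per-trial rate of the torsion-witness sampler: uncrowded
# ideals of bounded norm whose class has order divisible by `3`

Topic `Literature/Computability/Cryptography`; proof companion of
`HallgrenClassGroupTorsionWitnessCount.lean` (torsion witnesses are numerous) and
`HallgrenClassGroupCrowdedNorms.lean` (ideals with a crowded norm are few). Theorems only.

The unconditional torsion-witness test for `3 ∣ h(−d)` draws `a ≤ Y` uniformly, then an index
`k < R` uniformly, and reads (by one class-group order computation) whether the `k`-th ideal of norm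
`a` of `K = ℚ(√−d)` has a class of order divisible by `3`; ideals whose norm carries more than `R`
ideals are out of reach of the index. Its per-trial success count is therefore the number of

  **uncrowded torsion witnesses** `{𝔞 ≠ 0 : N𝔞 ≤ Y, r_K(N𝔞) ≤ R, 3 ∣ ord [𝔞]}`, `r_K(a) = #{𝔟 : N𝔟 = a}`,

bounded here from below:

* `le_card_ideals_three_dvd_orderOf_uncrowded` — if `d_K < −4` and `3 ∣ h_K` then
  `(2/3) h_K (2Y/√|d_K| − 2√Y − 1) − Y(1 + log Y)³/R ≤ #{uncrowded torsion witnesses}`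
  (witnesses minus crowded ideals);
* `le_card_ideals_three_dvd_orderOf_uncrowded_of_bright` — with a BRIGHT class number
  `h_K ≥ c√d/(π log d)` (`d = |d_K|`; this is `κ_K ≥ c/log d`), `h_K ≤ d`, `Y ≥ d³`,
  `R ≥ 3π(1 + log Y)³ log d / c` and `√d ≥ 6π log d / c`, the count is `≥ 2cY/(3π log d)`: a
  `1/poly(log d)` fraction of the `Y · R` pairs `(a, k)`;
* `ncard_ideals_norm_le_eq_sum` — the fibrewise decomposition
  `#{𝔞 ≠ 0 : N𝔞 ≤ Y, P 𝔞} = ∑_{a = 1}^{Y} #{𝔞 : N𝔞 = a, P 𝔞}` through which a sampler that first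
  draws the norm consumes such counts.

## References

* K. K. H. Cheung, M. Mosca, *Decomposing finite abelian groups*, QIC 1 (2001), §3 [CheungMosca2001].
* H. Davenport, *Multiplicative Number Theory*, 2nd ed., GTM 74 (1980), Ch. 6 [DavenportMNT1980].
* A. M. Childs, W. van Dam, Rev. Mod. Phys. 82 (2010), §5.7 [ChildsVandam2010].
-/

noncomputable section

open scoped nonZeroDivisors
open Module NumberField Finset
open Literature.NumberTheory.EllipticCurves

namespace Literature.Computability.Cryptography.Hallgren2005

variable {K : Type*} [Field K] [NumberField K]

/-- **Uncrowded torsion witnesses are numerous.** For an imaginary quadratic field `K` with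
`d_K < −4` and `3 ∣ h_K`, and `R ≥ 1`:
`(2/3) h_K (2Y/√|d_K| − 2√Y − 1) − Y(1 + log Y)³/R ≤ #{𝔞 ≠ 0 : N𝔞 ≤ Y, r_K(N𝔞) ≤ R, 3 ∣ ord [𝔞]}`
(every torsion witness of norm `≤ Y` is uncrowded or crowded: `le_card_ideals_three_dvd_orderOf`
minus `card_ideals_crowded_le`). [cite: CheungMosca2001, §3] -/
theorem le_card_ideals_three_dvd_orderOf_uncrowded (hK : IsImaginaryQuadratic K)
    (hd4 : NumberField.discr K < -4) (h3 : 3 ∣ Fintype.card (ClassGroup (𝓞 K))) (Y : ℕ) {R : ℕ}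
    (hR : 0 < R) :
    (2 / 3 : ℝ) * Fintype.card (ClassGroup (𝓞 K)) *
          (2 * Y / Real.sqrt (-(NumberField.discr K) : ℝ) - 2 * Real.sqrt Y - 1) -
        Y * (1 + Real.log Y) ^ 3 / R ≤
      Set.ncard {I : Ideal (𝓞 K) | I ≠ ⊥ ∧ Ideal.absNorm I ≤ Y ∧
        Nat.card {J : Ideal (𝓞 K) // Ideal.absNorm J = Ideal.absNorm I} ≤ R ∧
        ∃ hI : I ∈ (Ideal (𝓞 K))⁰, 3 ∣ orderOf (ClassGroup.mk0 ⟨I, hI⟩)} := by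
  classical
  set good : Set (Ideal (𝓞 K)) := {I | I ≠ ⊥ ∧ Ideal.absNorm I ≤ Y ∧
    ∃ hI : I ∈ (Ideal (𝓞 K))⁰, 3 ∣ orderOf (ClassGroup.mk0 ⟨I, hI⟩)} with hgood
  set crowd : Set (Ideal (𝓞 K)) := {I | I ≠ ⊥ ∧ Ideal.absNorm I ≤ Y ∧
    R < Nat.card {J : Ideal (𝓞 K) // Ideal.absNorm J = Ideal.absNorm I}} with hcrowd
  set target : Set (Ideal (𝓞 K)) := {I | I ≠ ⊥ ∧ Ideal.absNorm I ≤ Y ∧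
    Nat.card {J : Ideal (𝓞 K) // Ideal.absNorm J = Ideal.absNorm I} ≤ R ∧
    ∃ hI : I ∈ (Ideal (𝓞 K))⁰, 3 ∣ orderOf (ClassGroup.mk0 ⟨I, hI⟩)} with htarget
  have hfin : {I : Ideal (𝓞 K) | Ideal.absNorm I ≤ Y}.Finite := Ideal.finite_setOf_absNorm_le Y
  have htfin : target.Finite := hfin.subset fun I hI => hI.2.1
  have hcfin : crowd.Finite := hfin.subset fun I hI => hI.2.1
  have hsub : good ⊆ target ∪ crowd := by
    rintro I ⟨hI0, hIY, hI, h3I⟩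
    by_cases hc : Nat.card {J : Ideal (𝓞 K) // Ideal.absNorm J = Ideal.absNorm I} ≤ R
    · exact Or.inl ⟨hI0, hIY, hc, hI, h3I⟩
    · exact Or.inr ⟨hI0, hIY, not_le.1 hc⟩
  have hle : good.ncard ≤ target.ncard + crowd.ncard :=
    (Set.ncard_le_ncard hsub (htfin.union hcfin)).trans (Set.ncard_union_le _ _)
  have hle' : (good.ncard : ℝ) ≤ target.ncard + crowd.ncard := by exact_mod_cast hle
  have h1 := le_card_ideals_three_dvd_orderOf hK hd4 h3 Y
  have h2 := card_ideals_crowded_le (K := K) hK.finrank_eq_two Y hR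
  rw [← hgood] at h1
  rw [← hcrowd] at h2
  linarith

/-- **The per-trial rate under brightness.** For an imaginary quadratic field `K` with
`d_K = −d < −4`, `3 ∣ h_K`, a bright class number `c√d/(π log d) ≤ h_K` (i.e. `κ_K ≥ c/log d`),
`h_K ≤ d`, `log d > 0`, `√d ≥ 6π log d / c`, `Y ≥ d³` and `R ≥ 3π (1 + log Y)³ log d / c`:
`2cY/(3π log d) ≤ #{𝔞 ≠ 0 : N𝔞 ≤ Y, r_K(N𝔞) ≤ R, 3 ∣ ord [𝔞]}` (the main term
`(4/3) h_K Y/√d ≥ 4cY/(3π log d)` of `le_card_ideals_three_dvd_orderOf_uncrowded` dominates the two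
losses `(2/3) h_K (2√Y + 1) ≤ 2Y/√d` and `Y(1 + log Y)³/R`, each `≤ cY/(3π log d)`).
[cite: CheungMosca2001, §3] -/
theorem le_card_ideals_three_dvd_orderOf_uncrowded_of_bright (hK : IsImaginaryQuadratic K)
    (hd4 : NumberField.discr K < -4) (h3 : 3 ∣ Fintype.card (ClassGroup (𝓞 K))) {c : ℝ} (hc : 0 < c)
    {d : ℕ} (hKd : NumberField.discr K = -(d : ℤ))
    (hbright : c * Real.sqrt d / (Real.pi * Real.log d) ≤ Fintype.card (ClassGroup (𝓞 K)))
    (hhd : (Fintype.card (ClassGroup (𝓞 K)) : ℝ) ≤ d) (hlog : 0 < Real.log d)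
    (hd : 6 * Real.pi * Real.log d / c ≤ Real.sqrt d) {Y R : ℕ} (hY : (d : ℝ) ^ 3 ≤ Y) (hR : 0 < R)
    (hRge : 3 * Real.pi * (1 + Real.log Y) ^ 3 * Real.log d / c ≤ R) :
    2 * c * Y / (3 * Real.pi * Real.log d) ≤
      Set.ncard {I : Ideal (𝓞 K) | I ≠ ⊥ ∧ Ideal.absNorm I ≤ Y ∧
        Nat.card {J : Ideal (𝓞 K) // Ideal.absNorm J = Ideal.absNorm I} ≤ R ∧
        ∃ hI : I ∈ (Ideal (𝓞 K))⁰, 3 ∣ orderOf (ClassGroup.mk0 ⟨I, hI⟩)} := by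
  have h0 := le_card_ideals_three_dvd_orderOf_uncrowded hK hd4 h3 Y hR
  rw [hKd] at h0
  push_cast at h0
  rw [neg_neg] at h0
  set h : ℝ := (Fintype.card (ClassGroup (𝓞 K)) : ℝ) with hh
  have hπ : 0 < Real.pi := Real.pi_pos
  have hd1 : (1 : ℝ) < d := by
    by_contra hle
    exact absurd (Real.log_nonpos (Nat.cast_nonneg d) (not_lt.1 hle)) (not_le.2 hlog)
  have hd0 : (0 : ℝ) < d := by linarith
  have hsd : 0 < Real.sqrt d := Real.sqrt_pos.2 hd0
  have hsd2 : Real.sqrt d * Real.sqrt d = d := Real.mul_self_sqrt hd0.le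
  have hY1 : (1 : ℝ) ≤ Y := le_trans (one_le_pow₀ hd1.le) hY
  have hY0 : (0 : ℝ) ≤ Y := by linarith
  have hsY1 : 1 ≤ Real.sqrt Y := by rw [← Real.sqrt_one]; exact Real.sqrt_le_sqrt hY1
  have hsY : Real.sqrt Y * Real.sqrt Y = Y := Real.mul_self_sqrt hY0
  have hlogY : 0 ≤ 1 + Real.log Y := by linarith [Real.log_nonneg hY1]
  have hRpos : (0 : ℝ) < R := by exact_mod_cast hR
  -- main term
  have hmain : 4 * c * Y / (3 * Real.pi * Real.log d) ≤ (2 / 3 : ℝ) * h * (2 * Y / Real.sqrt d) := by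
    have e1 : (2 / 3 : ℝ) * h * (2 * Y / Real.sqrt d) = (4 / 3) * Y * (h / Real.sqrt d) := by ring
    have e2 : 4 * c * Y / (3 * Real.pi * Real.log d) =
        (4 / 3) * Y * (c * Real.sqrt d / (Real.pi * Real.log d) / Real.sqrt d) := by
      field_simp
    rw [e1, e2]
    refine mul_le_mul_of_nonneg_left ?_ (by positivity)
    exact div_le_div_of_nonneg_right hbright hsd.le
  -- first loss: `(2/3) h (2√Y + 1) ≤ 2 d √Y ≤ 2Y/√d ≤ cY/(3π log d)`
  have hloss1a : (2 / 3 : ℝ) * h * (2 * Real.sqrt Y + 1) ≤ 2 * d * Real.sqrt Y := by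
    have hhnn : 0 ≤ h := by rw [hh]; exact Nat.cast_nonneg _
    nlinarith
  have hloss1b : 2 * (d : ℝ) * Real.sqrt Y ≤ 2 * Y / Real.sqrt d := by
    rw [le_div_iff₀ hsd]
    -- `d^{3/2} √Y ≤ Y` from `d³ ≤ Y`
    have hY3 : (d : ℝ) * Real.sqrt d ≤ Real.sqrt Y := by
      have e : (d : ℝ) * Real.sqrt d = Real.sqrt ((d : ℝ) ^ 3) := by
        rw [show ((d : ℝ)) ^ 3 = (d * d) * d by ring, Real.sqrt_mul (by positivity), Real.sqrt_mul_self hd0.le]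
      rw [e]
      exact Real.sqrt_le_sqrt hY
    nlinarith [Real.sqrt_nonneg Y]
  have hloss1c : 2 * (Y : ℝ) / Real.sqrt d ≤ c * Y / (3 * Real.pi * Real.log d) := by
    rw [div_le_div_iff₀ hsd (by positivity)]
    have : 2 * (3 * Real.pi * Real.log d) ≤ c * Real.sqrt d := by
      have := (div_le_iff₀ hc).1 hd
      linarith
    nlinarith
  -- second loss
  have hloss2 : (Y : ℝ) * (1 + Real.log Y) ^ 3 / R ≤ c * Y / (3 * Real.pi * Real.log d) := by
    rw [div_le_div_iff₀ hRpos (by positivity)]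
    have hR' : 3 * Real.pi * (1 + Real.log Y) ^ 3 * Real.log d ≤ c * R := by
      have := (div_le_iff₀ hc).1 hRge
      linarith
    have : (Y : ℝ) * (1 + Real.log Y) ^ 3 * (3 * Real.pi * Real.log d) =
        Y * (3 * Real.pi * (1 + Real.log Y) ^ 3 * Real.log d) := by ring
    rw [this]
    calc (Y : ℝ) * (3 * Real.pi * (1 + Real.log Y) ^ 3 * Real.log d) ≤ Y * (c * R) :=
          mul_le_mul_of_nonneg_left hR' hY0
      _ = c * Y * R := by ring
  have hsplit : (2 / 3 : ℝ) * h * (2 * Y / Real.sqrt d - 2 * Real.sqrt Y - 1) =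
      (2 / 3 : ℝ) * h * (2 * Y / Real.sqrt d) - (2 / 3 : ℝ) * h * (2 * Real.sqrt Y + 1) := by ring
  have hfinal : 2 * c * Y / (3 * Real.pi * Real.log d) =
      4 * c * Y / (3 * Real.pi * Real.log d) - c * Y / (3 * Real.pi * Real.log d) -
        c * Y / (3 * Real.pi * Real.log d) := by ring
  rw [hfinal]
  rw [hsplit] at h0
  linarith

omit [NumberField K] in
/-- **Fibrewise decomposition by the norm**: `#{𝔞 ≠ 0 : N𝔞 ≤ Y, P 𝔞} = ∑_{a=1}^{Y} #{𝔞 : N𝔞 = a, P 𝔞}`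
in the ring of integers of a number field (a non-zero ideal has norm `≥ 1`, and there are finitely
many ideals of bounded norm). [folklore] -/
theorem ncard_ideals_norm_le_eq_sum [NumberField K] (P : Ideal (𝓞 K) → Prop) (Y : ℕ) :
    Set.ncard {I : Ideal (𝓞 K) | I ≠ ⊥ ∧ Ideal.absNorm I ≤ Y ∧ P I} =
      ∑ a ∈ Icc 1 Y, Set.ncard {I : Ideal (𝓞 K) | Ideal.absNorm I = a ∧ P I} := by
  classical
  set 𝓘 : Finset (Ideal (𝓞 K)) :=
    (Ideal.finite_setOf_absNorm_le (S := 𝓞 K) Y).toFinset.filter (fun I => I ≠ ⊥ ∧ P I) with h𝓘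
  have hmem𝓘 : ∀ {I : Ideal (𝓞 K)}, I ∈ 𝓘 ↔ I ≠ ⊥ ∧ Ideal.absNorm I ≤ Y ∧ P I := by
    intro I
    rw [h𝓘, mem_filter, Set.Finite.mem_toFinset, Set.mem_setOf_eq]
    tauto
  have hset : {I : Ideal (𝓞 K) | I ≠ ⊥ ∧ Ideal.absNorm I ≤ Y ∧ P I} = ↑𝓘 := by
    ext I; rw [Set.mem_setOf_eq, mem_coe, hmem𝓘]
  rw [hset, Set.ncard_coe_finset]
  have hmaps : (𝓘 : Set (Ideal (𝓞 K))).MapsTo (fun I => Ideal.absNorm I) (Icc 1 Y : Finset ℕ) := by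
    intro I hI
    obtain ⟨hI0, hIY, -⟩ := hmem𝓘.1 hI
    rw [mem_coe, mem_Icc]
    exact ⟨Nat.pos_of_ne_zero (mt Ideal.absNorm_eq_zero_iff.1 (by simpa using hI0)), hIY⟩
  rw [card_eq_sum_card_fiberwise hmaps]
  refine sum_congr rfl fun a ha => ?_
  have ha1 : 1 ≤ a ∧ a ≤ Y := mem_Icc.1 ha
  have hfib : {I : Ideal (𝓞 K) | Ideal.absNorm I = a ∧ P I} = ↑(𝓘.filter fun I => Ideal.absNorm I = a) := by
    ext I
    simp only [Set.mem_setOf_eq, coe_filter, hmem𝓘]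
    constructor
    · rintro ⟨hIa, hP⟩
      have hI0 : I ≠ ⊥ := by
        intro h; rw [h] at hIa; simp at hIa; omega
      exact ⟨⟨hI0, hIa ▸ ha1.2, hP⟩, hIa⟩
    · rintro ⟨⟨-, -, hP⟩, hIa⟩
      exact ⟨hIa, hP⟩
  rw [hfib, Set.ncard_coe_finset]

end Literature.Computability.Cryptography.Hallgren2005

end
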